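import Literature.NumberTheory.Transcendental.NesterenkoChowFormHypersurfaceK
import Literature.NumberTheory.Transcendental.NesterenkoCoeffNorms
import HarnessLib

/-!
# `P(Δ)` over an ARBITRARY field: row-homogeneity, non-vanishing, and `deg (P) = deg P` (LNM 1752 Ch. 3 Prop. 4.8 1))

`Literature/NumberTheory/Transcendental/NesterenkoHyperChowDegreeK.lean`. GENERIC-FIELD PORT of the
sections "Rows" and "Specialise" of the tree's `NesterenkoCoeffNorms.lean` (hard-wired to `ℚ[x̲]`)
for the generic hypersurface Chow form `NesterenkoK.hyperChow` / `NesterenkoK.genDelta K`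
(`NesterenkoChowFormHypersurfaceK.lean`): `P(Δ)` is homogeneous of degree `deg P` in each row of
the generic matrix (`hyperChow_isWeightedHomogeneous_row`, `blockDeg_hyperChow`), `P(Δ) ≠ 0` for
`P ≠ 0` (`hyperChow_ne_zero`, by the specialisation `specialise K` making `Δ₀ = ∏ (−xᵢ)`), and
hence **Prop. 4.8 1) over any field**: `NesterenkoK.ideg_span_singleton` — `deg (P) = deg P` for
the generic `NesterenkoK.ideg`. The field-free bookkeeping (`Nesterenko.rowWeight`,
`Nesterenko.weight_rowWeight`, `isWeightedHomogeneous_aeval_of_isHomogeneous`, the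
`l1Norm`/`maxNorm` calculus) is reused from the `ℚ` file. Chapter 10 of the book needs Prop. 4.8
over `K = ℂ(z)` (Thm 2.1 ⇐ Thm 2.2, p. 153).

## References

* [NesterenkoPhilippon2001] Yu. V. Nesterenko, P. Philippon (eds.), *Introduction to Algebraic
  Independence Theory*, LNM 1752, Springer 2001, Ch. 3 §4 Def. 4.5, Prop. 4.8 1) (pp. 38–40);
  Ch. 10 §2 (p. 153).
-/

noncomputable section

open MvPolynomial Matrix

namespace Literature.NumberTheory.Transcendental

namespace NesterenkoK

variable {K : Type*} [Field K] {m : ℕ}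

/-! ### `P(Δ)` is homogeneous of degree `deg P` in each row of `U` -/

section Rows

variable {m : ℕ}

/-- Each signed maximal minor `Δ_j` of the generic matrix is linear in every row `u_i`.
[folklore] -/
theorem genDelta_isWeightedHomogeneous_row (i : Fin m) (j : Fin (m + 1)) :
    IsWeightedHomogeneous (Nesterenko.rowWeight m i) (genDelta K m j) 1 := by
  have hN : ∀ τ : Equiv.Perm (Fin m), IsWeightedHomogeneous (Nesterenko.rowWeight m i)
      (∏ c, ((mvPolynomialX (Fin m) (Fin (m + 1)) K).submatrix id j.succAbove) (τ c) c) 1 := by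
    intro τ
    have h := IsWeightedHomogeneous.prod (R := K) (w := Nesterenko.rowWeight m i) Finset.univ
      (fun c : Fin m => (X (τ c, j.succAbove c) : (MvPolynomial (Fin m × Fin (m + 1)) K)))
      (fun c => Nesterenko.rowWeight m i (τ c, j.succAbove c)) fun c _ => isWeightedHomogeneous_X K _ _
    have hsum : ∑ c, Nesterenko.rowWeight m i (τ c, j.succAbove c) = 1 := by
      simp only [Nesterenko.rowWeight]
      rw [Equiv.sum_comp τ (fun a : Fin m => if (a : ℕ) = i then 1 else 0)]
      simp [Fin.val_eq_val, Finset.sum_ite_eq']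
    rw [hsum] at h
    exact h
  have hdet : IsWeightedHomogeneous (Nesterenko.rowWeight m i)
      ((mvPolynomialX (Fin m) (Fin (m + 1)) K).submatrix id j.succAbove).det 1 := by
    rw [Matrix.det_apply]
    refine IsWeightedHomogeneous.sum _ _ _ fun τ _ => ?_
    rw [Units.smul_def, ← Int.cast_smul_eq_zsmul K, ← C_mul']
    have := (isWeightedHomogeneous_C (Nesterenko.rowWeight m i)
      (((Equiv.Perm.sign τ : ℤˣ) : ℤ) : K)).mul (hN τ)
    rwa [zero_add] at this
  rw [genDelta, Nesterenko.maxMinor]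
  have hs : IsWeightedHomogeneous (Nesterenko.rowWeight m i) ((-1 : (MvPolynomial (Fin m × Fin (m + 1)) K)) ^ (j : ℕ)) 0 := by
    have := (isWeightedHomogeneous_C (σ := Fin m × Fin (m + 1)) (Nesterenko.rowWeight m i)
      ((-1 : K) ^ (j : ℕ)))
    rwa [C_pow, C_neg, C_1] at this
  have := hs.mul hdet
  rwa [zero_add] at this

/-- Substituting weight-`1` polynomials into a homogeneous polynomial of degree `d` gives a
weight-`d` polynomial. [folklore] -/
theorem isWeightedHomogeneous_aeval_of_isHomogeneous {σ τ M : Type*} [AddCommMonoid M]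
    {w : τ → M} {n : M} {g : σ → MvPolynomial τ K} (hg : ∀ v, IsWeightedHomogeneous w (g v) n)
    {P : MvPolynomial σ K} {d : ℕ} (hP : P.IsHomogeneous d) :
    IsWeightedHomogeneous w (aeval g P) (d • n) := by
  classical
  rw [P.as_sum, map_sum]
  refine IsWeightedHomogeneous.sum _ _ _ fun γ hγ => ?_
  rw [aeval_monomial, ← C_eq_algebraMap]
  refine IsWeightedHomogeneous.C_mul ?_ _
  rw [Finsupp.prod, hP.degree_eq_sum_deg_support hγ, Finset.sum_smul]
  refine IsWeightedHomogeneous.prod _ _ _ fun v _ => ?_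
  exact (hg v).pow _

/-- **`P(Δ)` is homogeneous of degree `d = deg P` in each row `u_i`.**
[cite: NesterenkoPhilippon2001, Ch. 3 Prop. 4.8 1) (p. 40)] -/
theorem hyperChow_isWeightedHomogeneous_row {P : (MvPolynomial (Fin (m + 1)) K)} {d : ℕ} (hP : P.IsHomogeneous d)
    (i : Fin m) : IsWeightedHomogeneous (Nesterenko.rowWeight m i) (hyperChow P) d := by
  have h := isWeightedHomogeneous_aeval_of_isHomogeneous
    (genDelta_isWeightedHomogeneous_row i) hP
  rw [smul_eq_mul, mul_one] at h
  exact h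

/-- Every monomial of `P(Δ)` has degree `d` in each row. [folklore] -/
theorem sum_eq_of_mem_support_hyperChow {P : (MvPolynomial (Fin (m + 1)) K)} {d : ℕ} (hP : P.IsHomogeneous d)
    {β : Fin m × Fin (m + 1) →₀ ℕ} (hβ : β ∈ (hyperChow P).support) (i : Fin m) :
    ∑ j, β (i, j) = d := by
  rw [← Nesterenko.weight_rowWeight]
  exact hyperChow_isWeightedHomogeneous_row hP i (mem_support_iff.mp hβ)

/-- **`deg_{u_1} P(Δ) = deg P`** (for `P(Δ) ≠ 0`). [cite: NesterenkoPhilippon2001, Ch. 3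
Prop. 4.8 1) (p. 40)] -/
theorem blockDeg_hyperChow {P : (MvPolynomial (Fin (m + 1)) K)} {d : ℕ} (hP : P.IsHomogeneous d) (hF : hyperChow P ≠ 0)
    (i : Fin m) : blockDeg (hyperChow P) i = d := by
  rw [blockDeg]
  refine le_antisymm (Finset.sup_le fun β hβ => (sum_eq_of_mem_support_hyperChow hP hβ i).le) ?_
  obtain ⟨β, hβ⟩ := support_nonempty.mpr hF
  exact (sum_eq_of_mem_support_hyperChow hP hβ i).ge.trans
    (Finset.le_sup (f := fun e : Fin m × Fin (m + 1) →₀ ℕ => ∑ j, e (i, j)) hβ)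

/-- **`P(Δ)` has at most `(m+1)^{md}` monomials.** [folklore] -/
theorem card_support_hyperChow_le {P : (MvPolynomial (Fin (m + 1)) K)} {d : ℕ} (hP : P.IsHomogeneous d) :
    (hyperChow P).support.card ≤ (m + 1) ^ (m * d) := by
  have hrow : ∀ β ∈ (hyperChow P).support, ∀ i : Fin m,
      Finsupp.curry β i ∈ Nesterenko.degMonomials (m + 1) d := by
    intro β hβ i
    refine Nesterenko.mem_degMonomials ?_
    rw [← sum_eq_of_mem_support_hyperChow hP hβ i, Finsupp.degree_eq_sum]
    rfl
  calc (hyperChow P).support.card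
      ≤ (Fintype.piFinset fun _ : Fin m => Nesterenko.degMonomials (m + 1) d).card := by
        refine Finset.card_le_card_of_injOn (fun β i => Finsupp.curry β i)
          (fun β hβ => Fintype.mem_piFinset.mpr (hrow β hβ)) ?_
        intro β _ β' _ h
        ext ⟨i, j⟩
        have := congrFun h i
        simp only at this
        rw [← Finsupp.curry_apply β i j, ← Finsupp.curry_apply β' i j, this]
    _ ≤ (m + 1) ^ (m * d) := by
        rw [Fintype.card_piFinset, Finset.prod_const, Finset.card_univ, Fintype.card_fin,
          mul_comm m d, pow_mul]
        exact Nat.pow_le_pow_left (Nesterenko.card_degMonomials_le _ _) _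

end Rows

/-! ### The specialisation `U ↦ U(t)` -/

section Specialise

variable {m : ℕ}

variable (K) in
/-- Row `i` of `U(t)`: `t_{i+1} e_i − t_i e_{i+1}` (orthogonal to `t̄ = (t_0, …, t_m)`).
[folklore] -/
def specRow (m : ℕ) (i : Fin m) : Fin (m + 1) → (MvPolynomial (Fin (m + 1)) K) :=
  Pi.single (Fin.castSucc i) (X i.succ) - Pi.single i.succ (X (Fin.castSucc i))

variable (K) in
/-- The matrix `U(t)`. [folklore] -/
def specMat (m : ℕ) : Matrix (Fin m) (Fin (m + 1)) (MvPolynomial (Fin (m + 1)) K) :=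
  Matrix.of (specRow K m)

variable (K) in
/-- The substitution `u_{ij} ↦ U(t)_{ij}`, `K[U] → K[t_0, …, t_m]`. [folklore] -/
def specialise (m : ℕ) : (MvPolynomial (Fin m × Fin (m + 1)) K) →ₐ[K] (MvPolynomial (Fin (m + 1)) K) :=
  aeval fun v => specMat K m v.1 v.2

/-- `specialise` unfolded. [folklore] -/
theorem specialise_apply (F : (MvPolynomial (Fin m × Fin (m + 1)) K)) :
    specialise K m F = aeval (fun v : Fin m × Fin (m + 1) => specMat K m v.1 v.2) F := rfl

/-- `U(t) t̄ = 0`. [folklore] -/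
theorem specMat_mulVec_X : specMat K m *ᵥ (fun j => X j) = 0 := by
  funext i
  change specRow K m i ⬝ᵥ (fun j => X j) = 0
  rw [specRow, sub_dotProduct, single_dotProduct, single_dotProduct]
  ring

/-- `Δ_j(U(t))` is the specialisation of `Δ_j`. [folklore] -/
theorem specialise_genDelta (j : Fin (m + 1)) :
    specialise K m (genDelta K m j) = Nesterenko.maxMinor (specMat K m) j := by
  rw [genDelta, specialise, show (aeval fun v : Fin m × Fin (m + 1) => specMat K m v.1 v.2)
      (Nesterenko.maxMinor (mvPolynomialX (Fin m) (Fin (m + 1)) K) j) =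
      (aeval fun v : Fin m × Fin (m + 1) => specMat K m v.1 v.2).toRingHom
        (Nesterenko.maxMinor (mvPolynomialX (Fin m) (Fin (m + 1)) K) j) from rfl, Nesterenko.map_maxMinor]
  congr 1
  ext i k
  simp [mvPolynomialX]

/-- `Δ_0(U(t)) = (−t_0) ⋯ (−t_{m−1})` (a lower triangular determinant). [folklore] -/
theorem maxMinor_specMat_zero : Nesterenko.maxMinor (specMat K m) 0 = ∏ i : Fin m, -X (Fin.castSucc i) := by
  rw [Nesterenko.maxMinor, Fin.val_zero, pow_zero, one_mul, Matrix.det_of_lowerTriangular _ ?_]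
  · refine Finset.prod_congr rfl fun i _ => ?_
    simp [specMat, specRow, (Fin.castSucc_lt_succ (i := i)).ne']
  · intro i c hlt
    replace hlt : i < c := hlt
    have h1 : c.succ ≠ Fin.castSucc i := by
      intro h
      have := congrArg Fin.val h
      simp only [Fin.val_succ, Fin.val_castSucc] at this
      have := hlt; rw [Fin.lt_def] at this
      omega
    have h2 : c.succ ≠ i.succ := fun h => hlt.ne' (Fin.succ_inj.mp h)
    simp [specMat, specRow, h1, h2]

/-- `(−t_0) ⋯ (−t_{m−1}) ≠ 0`. [folklore] -/
theorem prod_neg_X_castSucc_ne_zero : (∏ i : Fin m, -X (Fin.castSucc i) : (MvPolynomial (Fin (m + 1)) K)) ≠ 0 :=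
  Finset.prod_ne_zero_iff.mpr fun _ _ => neg_ne_zero.mpr (X_ne_zero _)

/-- **The specialisation identity**: `t_0^d · P(Δ)(U(t)) = Δ_0(U(t))^d · P(t̄)` for `P`
homogeneous of degree `d` (because `Δ(U(t))` is proportional to `t̄`). [folklore] -/
theorem specialise_hyperChow {P : (MvPolynomial (Fin (m + 1)) K)} {d : ℕ} (hP : P.IsHomogeneous d) :
    X 0 ^ d * specialise K m (hyperChow P) = Nesterenko.maxMinor (specMat K m) 0 ^ d * P := by
  rw [hyperChow, map_aeval_eq]
  simp_rw [specialise_genDelta]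
  rw [← aeval_mul_of_isHomogeneous hP (X 0) (Nesterenko.maxMinor (specMat K m))]
  have : (fun j => X 0 * Nesterenko.maxMinor (specMat K m) j) = fun j => Nesterenko.maxMinor (specMat K m) 0 * X j := by
    funext j
    rw [mul_comm]
    exact (Nesterenko.maxMinor_mul_eq_of_mulVec_eq_zero (specMat K m) (fun j => X j) specMat_mulVec_X j 0).symm
  rw [this, aeval_mul_of_isHomogeneous hP, aeval_X_left_apply]

/-- **`P(Δ) ≠ 0`** for `P ≠ 0` homogeneous: the maximal minors of the generic matrix are
algebraically independent enough. [cite: NesterenkoPhilippon2001, Ch. 3 Prop. 4.8 1) (p. 40)] -/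
theorem hyperChow_ne_zero {P : (MvPolynomial (Fin (m + 1)) K)} {d : ℕ} (hP : P.IsHomogeneous d) (hP0 : P ≠ 0) :
    hyperChow P ≠ 0 := by
  intro h
  have := specialise_hyperChow hP (m := m)
  rw [h, map_zero, mul_zero] at this
  exact mul_ne_zero (pow_ne_zero _ (maxMinor_specMat_zero (K := K) (m := m) ▸ prod_neg_X_castSucc_ne_zero (K := K)))
    hP0 this.symm

end Specialise

/-! ### Proposition 4.8 1) over any field -/

/-- `deg_{u_i}` ignores non-zero constant factors. [folklore] -/
theorem blockDeg_C_mul' {r : ℕ} {c : K} (hc : c ≠ 0) (F : MvPolynomial (Fin r × Fin (m + 1)) K)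
    (i : Fin r) : blockDeg (C c * F) i = blockDeg F i := by
  rw [blockDeg, blockDeg, C_mul', support_smul_eq hc]

/-- **Prop. 4.8 1) over an arbitrary field**: `deg (P) = deg P` for a non-zero form `P` of degree
`d ≥ 1` in `m + 1 ≥ 2` variables. [cite: NesterenkoPhilippon2001, Ch. 3 Prop. 4.8 1) (p. 40)] -/
theorem ideg_span_singleton {P : MvPolynomial (Fin (m + 1)) K} {d : ℕ} (hm : 1 ≤ m) (hP0 : P ≠ 0)
    (hP : P.IsHomogeneous d) (hd : 0 < d) : ideg (Ideal.span {P}) m = d := by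
  obtain ⟨c, hc, hcf⟩ := chowForm_span_singleton hP hd
  rw [ideg, dif_pos (by omega : 0 < m), hcf, blockDeg_C_mul' hc,
    blockDeg_hyperChow hP (hyperChow_ne_zero hP hP0)]

end NesterenkoK

end Literature.NumberTheory.Transcendental

end
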